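import Mathlib
import Summits.Ventures.PercRepro2.Defs
import Summits.Ventures.PercRepro2.Graph
import Summits.Ventures.PercRepro2.Harris
import Summits.Ventures.PercRepro2.RowC1Cross
import Summits.Ventures.PercRepro2.RowC1CrossIdentity

/-!
# The merged-world dominance ⟹ the cross term (blind cell PercRepro2, p2 g34;
proofs/P2-G34-ROOT.md §14–§15)

The candidate (C1-ZG) of the seat says that at every edge `e = a₂v` the cross term dominates the
merged world's row: `P⁰(Q) · c1Slack p[e↦1] ≤ P¹(Q) · c1Cross p e` (⟺ by the cross-term identity
`(P¹(Q))² · c1Slack p[e↦0] + (A⁰C¹ − A¹C⁰)(A⁰D¹ − A¹D⁰) ≥ 0`; exact on 1,205,907 random `a₂`-type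
edges and 364 descent alarms, kits j335206 / j335254; its `a₁`-side version is false, NEG-244).
This file records the one step that makes it useful for the one-edge induction of
`c1Slack_nonneg_of_cross`: **the dominance at `e` together with the row for the open pin gives
`c1Cross p e ≥ 0`** (`c1Cross_nonneg_of_dom`; if `P¹(Q) = 0` the cross term vanishes), and the
equivalent bracket form (`dom_iff_bracket`, from `c1Cross_mul_eq`).  Std axioms.
-/

namespace Summit.Ventures.PercRepro2

namespace RowC1

section ZG

variable {V : Type*} {E : Type*} [Fintype E] [DecidableEq E] [Fintype V] [DecidableEq V]
  {R : Type*} [Field R] [LinearOrder R] [IsStrictOrderedRing R]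

omit [Fintype V] [DecidableEq V] in
/-- **Dominance ⟹ cross term**: if `P⁰(Q) · Row¹ ≤ P¹(Q) · c1Cross p e` and `0 ≤ Row¹`, then
`0 ≤ c1Cross p e`. -/
theorem c1Cross_nonneg_of_dom (p : E → R) (hp : IsProbVec p) (ends : E → Sym2 V)
    (a₁ a₂ o b : V) (e : E)
    (hdom : prob (Function.update p e (0 : R)) (connEvent ends a₁ a₂)ᶜ *
        c1Slack (Function.update p e (1 : R)) ends a₁ a₂ o b ≤
      prob (Function.update p e (1 : R)) (connEvent ends a₁ a₂)ᶜ * c1Cross p ends a₁ a₂ o b e)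
    (h1 : 0 ≤ c1Slack (Function.update p e (1 : R)) ends a₁ a₂ o b) :
    0 ≤ c1Cross p ends a₁ a₂ o b e := by
  have hA0 : 0 ≤ prob (Function.update p e (0 : R)) (connEvent ends a₁ a₂)ᶜ :=
    prob_nonneg (hp.update e le_rfl zero_le_one) _
  have hA1 : 0 ≤ prob (Function.update p e (1 : R)) (connEvent ends a₁ a₂)ᶜ :=
    prob_nonneg (hp.update e zero_le_one le_rfl) _
  rcases hA1.lt_or_eq with hpos | hzero
  · have h : 0 ≤ prob (Function.update p e (1 : R)) (connEvent ends a₁ a₂)ᶜ *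
        c1Cross p ends a₁ a₂ o b e := le_trans (mul_nonneg hA0 h1) hdom
    exact (mul_nonneg_iff_of_pos_left hpos).1 h
  · have hz : prob (Function.update p e (0 : R)) (connEvent ends a₁ a₂)ᶜ *
        prob (Function.update p e (1 : R)) (connEvent ends a₁ a₂)ᶜ = 0 := by
      rw [← hzero, mul_zero]
    rw [c1Cross_eq_zero_of_mul_eq_zero p hp ends a₁ a₂ o b e hz]

omit [Fintype V] [DecidableEq V] [LinearOrder R] [IsStrictOrderedRing R] in
/-- **The dominance in bracket form** (from the cross-term identity):
`P⁰(Q) · (P¹(Q) · c1Cross p e − P⁰(Q) · Row¹) = (P¹(Q))² · Row⁰ + (A⁰C¹ − A¹C⁰)(A⁰D¹ − A¹D⁰)`,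
so the dominance at `e` is the nonnegativity of the right side whenever `P⁰(Q) > 0`. -/
theorem dom_sub_eq_bracket (p : E → R) (ends : E → Sym2 V) (a₁ a₂ o b : V) (e : E) :
    prob (Function.update p e (0 : R)) (connEvent ends a₁ a₂)ᶜ *
        (prob (Function.update p e (1 : R)) (connEvent ends a₁ a₂)ᶜ * c1Cross p ends a₁ a₂ o b e -
          prob (Function.update p e (0 : R)) (connEvent ends a₁ a₂)ᶜ *
            c1Slack (Function.update p e (1 : R)) ends a₁ a₂ o b) =
      (prob (Function.update p e (1 : R)) (connEvent ends a₁ a₂)ᶜ) ^ 2 *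
          c1Slack (Function.update p e (0 : R)) ends a₁ a₂ o b +
        (prob (Function.update p e (0 : R)) (connEvent ends a₁ a₂)ᶜ *
            prob (Function.update p e (1 : R)) (connEvent ends a₂ b ∩ (connEvent ends a₁ a₂)ᶜ) -
          prob (Function.update p e (1 : R)) (connEvent ends a₁ a₂)ᶜ *
            prob (Function.update p e (0 : R)) (connEvent ends a₂ b ∩ (connEvent ends a₁ a₂)ᶜ)) *
        (prob (Function.update p e (0 : R)) (connEvent ends a₁ a₂)ᶜ *
            prob (Function.update p e (1 : R))
              ((connEvent ends a₁ o ∪ connEvent ends a₂ o) ∩ (connEvent ends a₁ a₂)ᶜ) -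
          prob (Function.update p e (1 : R)) (connEvent ends a₁ a₂)ᶜ *
            prob (Function.update p e (0 : R))
              ((connEvent ends a₁ o ∪ connEvent ends a₂ o) ∩ (connEvent ends a₁ a₂)ᶜ)) := by
  have h := c1Cross_mul_eq p ends a₁ a₂ o b e
  linear_combination h

end ZG

end RowC1

end Summit.Ventures.PercRepro2
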